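import Literature.NumberTheory.Sieve.HeathBrownMorozResidueClasses
import Literature.NumberTheory.Sieve.CubicFormLocalCount
import Mathlib.Data.Nat.Factorization.Induction
import HarnessLib

/-!
# The local-density identity `w(d) · ν*_d = d²` for `x³ + 2y³`, PROVED

Topic `Literature/NumberTheory/Sieve`, namespace `Literature.NumberTheory.Sieve.CubicPrimes`
(continuation of `HeathBrownMorozResidueClasses.lean`, `CubicFormLocalCount.lean`).

Heath-Brown–Moroz's local correction `w(d) = ∏_{p ∣ d} p²(p+1)/((p²−1)(p+1−ν_p))` of the class
asymptotic for primes `x³ + 2y³` with `(x, y)` in a class mod `d` [HeathBrownMoroz2004, (3.1), Lemma 2.4]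
is, for squarefree `d`, exactly `d²/ν*_d` with `ν*_d = #{(a,b) mod d : (a³+2b³, d) = 1}` the number
of admissible classes (`classWeight_mul_card_coprimeClasses`): at a prime this is
`ν*_p = (p−1)(p+1−ν_p)` (`card_admissiblePairs` of `CubicFormLocalCount.lean`, [HeathBrownMoroz2004,
§2 (2.36)]), and both sides are multiplicative (Chinese remainder theorem, `card_coprimeClasses_mul`).
Consequently the class densities `ρ(d, r) = ν_d(r)/ν*_d` of the parity-ideate route
`GoldbachHeathBrownDispersion` equal `ν_d(r)·w(d)/d²` (`classDensity_eq_classWeight_div_sq_mul`) — the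
«classWeight algebra» of its support item «ClassTransfer».  No new facts.  Written for the
parity-ideate cell (literature seat g14, 2026-08-27).

## References

* [HeathBrownMoroz2004] D. R. Heath-Brown, B. Z. Moroz, *On primes represented by cubic polynomials*,
  Proc. LMS (3) 88 (2004), §2 (2.36), Lemma 2.4, §3 (3.1).
-/

noncomputable section

open Finset

namespace Literature.NumberTheory.Sieve.CubicPrimes

/-! ### `ν*_m` through `ZMod m`, at primes, and multiplicativity -/

/-- `ν*_m = #{(x, y) ∈ (ℤ/m)² : x³ + 2y³ ∈ (ℤ/m)ˣ}`. [cite: HeathBrownMoroz2004, §3 (3.1)] -/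
theorem card_coprimeClasses_eq_card_zmod (m : ℕ) [NeZero m] :
    #{ab ∈ range m ×ˢ range m | Nat.Coprime (ab.1 ^ 3 + 2 * ab.2 ^ 3) m} =
      #{v : ZMod m × ZMod m | IsUnit (v.1 ^ 3 + 2 * v.2 ^ 3)} := by
  classical
  refine Finset.card_nbij' (fun uv => ((uv.1 : ZMod m), (uv.2 : ZMod m)))
    (fun v => (v.1.val, v.2.val)) ?_ ?_ ?_ ?_
  · intro uv huv
    rw [mem_coe, mem_filter, mem_product, mem_range, mem_range] at huv
    simp only [mem_coe, mem_filter, mem_univ, true_and]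
    have h := (ZMod.isUnit_iff_coprime (uv.1 ^ 3 + 2 * uv.2 ^ 3) m).mpr huv.2
    push_cast at h
    exact h
  · intro v hv
    simp only [mem_coe, mem_filter, mem_univ, true_and] at hv
    rw [mem_coe, mem_filter, mem_product, mem_range, mem_range]
    refine ⟨⟨ZMod.val_lt v.1, ZMod.val_lt v.2⟩, ?_⟩
    rw [← ZMod.isUnit_iff_coprime]
    push_cast
    rw [ZMod.natCast_zmod_val, ZMod.natCast_zmod_val]
    exact hv
  · intro uv huv
    rw [mem_coe, mem_filter, mem_product, mem_range, mem_range] at huv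
    simp only [ZMod.val_natCast_of_lt huv.1.1, ZMod.val_natCast_of_lt huv.1.2]
  · intro v _
    simp only [ZMod.natCast_zmod_val]

/-- **`ν*_p = (p − 1)(p + 1 − ν_p)` at a prime** (`card_admissiblePairs`).
[cite: HeathBrownMoroz2004, §2 (2.36)] -/
theorem card_coprimeClasses_prime {p : ℕ} (hp : p.Prime) :
    #{ab ∈ range p ×ˢ range p | Nat.Coprime (ab.1 ^ 3 + 2 * ab.2 ^ 3) p} =
      (p - 1) * (p + 1 - cubeRootTwoCount p) := by
  classical
  haveI : Fact p.Prime := ⟨hp⟩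
  rw [card_coprimeClasses_eq_card_zmod, ← card_admissiblePairs]
  congr 1
  ext v
  simp only [mem_filter, mem_univ, true_and, isUnit_iff_ne_zero]

/-- **`ν*` is multiplicative** (Chinese remainder theorem in both coordinates): `ν*_{mn} = ν*_m ν*_n`
for coprime `m, n`. [cite: HeathBrownMoroz2004, Lemma 2.4 (multiplicativity of the local counts)] -/
theorem card_coprimeClasses_mul {m n : ℕ} (hm : m ≠ 0) (hn : n ≠ 0) (h : m.Coprime n) :
    #{ab ∈ range (m * n) ×ˢ range (m * n) | Nat.Coprime (ab.1 ^ 3 + 2 * ab.2 ^ 3) (m * n)} =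
      #{ab ∈ range m ×ˢ range m | Nat.Coprime (ab.1 ^ 3 + 2 * ab.2 ^ 3) m} *
        #{ab ∈ range n ×ˢ range n | Nat.Coprime (ab.1 ^ 3 + 2 * ab.2 ^ 3) n} := by
  classical
  haveI : NeZero m := ⟨hm⟩
  haveI : NeZero n := ⟨hn⟩
  haveI : NeZero (m * n) := ⟨mul_ne_zero hm hn⟩
  rw [card_coprimeClasses_eq_card_zmod, card_coprimeClasses_eq_card_zmod,
    card_coprimeClasses_eq_card_zmod, ← card_product]
  set ψ := ZMod.chineseRemainder h with hψ
  refine card_nbij' (fun v => (((ψ v.1).1, (ψ v.2).1), ((ψ v.1).2, (ψ v.2).2)))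
    (fun w => (ψ.symm (w.1.1, w.2.1), ψ.symm (w.1.2, w.2.2))) ?_ ?_ ?_ ?_
  · intro v hv
    simp only [mem_coe, mem_filter, mem_univ, true_and] at hv
    simp only [mem_coe, mem_product, mem_filter, mem_univ, true_and]
    have key : IsUnit (ψ (v.1 ^ 3 + 2 * v.2 ^ 3)) := hv.map ψ
    rw [map_add, map_mul, map_pow, map_pow, map_ofNat, Prod.isUnit_iff] at key
    simp only [Prod.fst_add, Prod.fst_mul, Prod.pow_fst, Prod.fst_ofNat,
      Prod.snd_add, Prod.snd_mul, Prod.pow_snd, Prod.snd_ofNat] at key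
    exact key
  · intro w hw
    simp only [mem_coe, mem_product, mem_filter, mem_univ, true_and] at hw
    simp only [mem_coe, mem_filter, mem_univ, true_and]
    rw [← isUnit_map_iff ψ, map_add, map_mul, map_pow, map_pow, map_ofNat,
      RingEquiv.apply_symm_apply, RingEquiv.apply_symm_apply, Prod.isUnit_iff]
    simp only [Prod.fst_add, Prod.fst_mul, Prod.pow_fst, Prod.fst_ofNat,
      Prod.snd_add, Prod.snd_mul, Prod.pow_snd, Prod.snd_ofNat]
    exact hw
  · intro v _
    simp
  · intro w _
    simp

/-! ### The local correction `w(d)` -/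

/-- `w` is multiplicative on coprime arguments. [cite: HeathBrownMoroz2004, §3 (3.1)] -/
theorem classWeight_mul_of_coprime {m n : ℕ} (hm : m ≠ 0) (hn : n ≠ 0) (h : m.Coprime n) :
    classWeight (m * n) = classWeight m * classWeight n := by
  rw [classWeight_def, classWeight_def, classWeight_def, Nat.primeFactors_mul hm hn,
    prod_union h.disjoint_primeFactors]

/-- `w(p) = classWeightFactor p` at a prime. [cite: HeathBrownMoroz2004, §3 (3.1)] -/
theorem classWeight_prime {p : ℕ} (hp : p.Prime) : classWeight p = classWeightFactor p := by
  rw [classWeight_def, hp.primeFactors, prod_singleton]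

/-- **The local-density identity** `w(d) · ν*_d = d²` for squarefree `d`: at a prime
`w(p)(p−1)(p+1−ν_p) = p²` (`classWeightFactor_mul`, `card_admissiblePairs`), and both sides are
multiplicative. [cite: HeathBrownMoroz2004, §3 (3.1) with §2 (2.36)] -/
theorem classWeight_mul_card_coprimeClasses {d : ℕ} (hd : Squarefree d) :
    classWeight d * (#{ab ∈ range d ×ˢ range d | Nat.Coprime (ab.1 ^ 3 + 2 * ab.2 ^ 3) d} : ℝ) =
      (d : ℝ) ^ 2 := by
  induction d using Nat.recOnPosPrimePosCoprime with
  | prime_pow p n hp hn =>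
    rcases Nat.lt_or_ge 1 n with hn1 | hn1
    · -- `p^n` with `n ≥ 2` is not squarefree
      exfalso
      have hdvd : p * p ∣ p ^ n := by
        rw [← sq]; exact pow_dvd_pow p hn1
      have hu := hd p hdvd
      rw [Nat.isUnit_iff] at hu
      exact hp.one_lt.ne' hu
    · have hn' : n = 1 := le_antisymm hn1 hn
      subst hn'
      rw [pow_one] at hd ⊢
      rw [classWeight_prime hp, card_coprimeClasses_prime hp]
      have h1 : 1 ≤ p := hp.one_lt.le
      have h2 : cubeRootTwoCount p ≤ p + 1 := (cubeRootTwoCount_le p).trans (Nat.le_succ p)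
      push_cast [Nat.cast_sub h1, Nat.cast_sub h2]
      exact classWeightFactor_mul hp
  | zero => exact absurd hd not_squarefree_zero
  | one =>
    have h : #{ab ∈ range 1 ×ˢ range 1 | Nat.Coprime (ab.1 ^ 3 + 2 * ab.2 ^ 3) 1} = 1 := by decide
    rw [classWeight_one, h]; norm_num
  | coprime a b ha hb hab iha ihb =>
    obtain ⟨-, hsa, hsb⟩ := Nat.squarefree_mul_iff.mp hd
    rw [classWeight_mul_of_coprime (by omega) (by omega) hab,
      card_coprimeClasses_mul (by omega) (by omega) hab]
    push_cast
    rw [mul_pow, ← iha hsa, ← ihb hsb]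
    ring

/-- `ν*_d ≥ 1` for squarefree `d` (e.g. the class of `(1, 0)`); here from the identity.
[cite: HeathBrownMoroz2004, §3 (3.1)] -/
theorem card_coprimeClasses_pos {d : ℕ} (hd : Squarefree d) :
    0 < #{ab ∈ range d ×ˢ range d | Nat.Coprime (ab.1 ^ 3 + 2 * ab.2 ^ 3) d} := by
  have hd0 : d ≠ 0 := fun h => not_squarefree_zero (h ▸ hd)
  have h := classWeight_mul_card_coprimeClasses hd
  by_contra h0
  push Not at h0
  have hz : #{ab ∈ range d ×ˢ range d | Nat.Coprime (ab.1 ^ 3 + 2 * ab.2 ^ 3) d} = 0 := by omega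
  rw [hz, Nat.cast_zero, mul_zero] at h
  have : (0 : ℝ) < (d : ℝ) ^ 2 := by positivity
  linarith

/-- **The route's class density is `ν_d(r) w(d)/d²`**: for squarefree `d`,
`#{(a,b) : a³+2b³ ≡ r, admissible}/ν*_d = (w(d)/d²) · #{(a,b) : a³+2b³ ≡ r, admissible}`
(the «classWeight algebra» of the parity-ideate item «ClassTransfer»). [cite: HeathBrownMoroz2004, §3 (3.1) with §2 (2.36)] -/
theorem classDensity_eq_classWeight_div_sq_mul {d : ℕ} (hd : Squarefree d) (r : ℕ) :
    (#{ab ∈ range d ×ˢ range d | ab.1 ^ 3 + 2 * ab.2 ^ 3 ≡ r [MOD d] ∧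
        Nat.Coprime (ab.1 ^ 3 + 2 * ab.2 ^ 3) d} : ℝ) /
      (#{ab ∈ range d ×ˢ range d | Nat.Coprime (ab.1 ^ 3 + 2 * ab.2 ^ 3) d} : ℝ) =
      classWeight d / (d : ℝ) ^ 2 *
        #{ab ∈ range d ×ˢ range d | ab.1 ^ 3 + 2 * ab.2 ^ 3 ≡ r [MOD d] ∧
          Nat.Coprime (ab.1 ^ 3 + 2 * ab.2 ^ 3) d} := by
  have hd0 : d ≠ 0 := fun h => not_squarefree_zero (h ▸ hd)
  have hν : (0 : ℝ) < #{ab ∈ range d ×ˢ range d | Nat.Coprime (ab.1 ^ 3 + 2 * ab.2 ^ 3) d} := by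
    exact_mod_cast card_coprimeClasses_pos hd
  have hd2 : (0 : ℝ) < (d : ℝ) ^ 2 := by positivity
  have h := classWeight_mul_card_coprimeClasses hd
  rw [div_eq_iff hν.ne', mul_comm (classWeight d / (d : ℝ) ^ 2), mul_assoc,
    div_mul_eq_mul_div, h, div_self hd2.ne', mul_one]

end Literature.NumberTheory.Sieve.CubicPrimes

end
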